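import Summits.Ventures.PercRepro.OrbitK

/-!
# PercRepro — `Φ(10, 7) = 5/2` AND `Φ(9, 7) = 9/8` (p7 g23; the two constants of the row-10 device at level `7`)

The level-7 constants of the lower end: `Φ(10, 7) = (C(17,8) + C(17,9)) / C(17,10) = 5/2` and `Φ(9, 7) = C(16,8) / C(16,9) = 9/8`
(so the lossy ladder's `κ₁ = (Φ(10,7) − 2)/2 = 1/4 ≤ Φ(9,7)`). Nothing else is claimed.

* `phiK_ten_seven`, `phiK_nine_seven`.
Axioms: standard.
-/

namespace PercRepro

namespace S4Ups

/-- `Φ(10, 7) = 5/2` exactly. -/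
theorem phiK_ten_seven : phiK 10 7 = 5 / 2 := by
  unfold phiK
  rw [show Finset.Ioo 7 10 = Finset.Icc 8 9 by decide]
  norm_num [Finset.sum_Icc_succ_top, Nat.choose]

/-- `Φ(9, 7) = 9/8` exactly. -/
theorem phiK_nine_seven : phiK 9 7 = 9 / 8 := by
  unfold phiK
  rw [show Finset.Ioo 7 9 = {8} from by decide, Finset.sum_singleton]
  norm_num [Nat.choose]

end S4Ups

end PercRepro
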